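import Summits.BirchSwinnertonDyer.BirchSwinnertonDyer.Theorems.GenusKolyvaginAtTwoGenusPrimitiveSupplyAtTwoArchimedeanSupplyFree
import Summits.BirchSwinnertonDyer.BirchSwinnertonDyer.Theorems.GenusKolyvaginAtTwoGenusPrimitiveSupplyAtTwoArchimedeanEggTwistLaw
import Summits.BirchSwinnertonDyer.BirchSwinnertonDyer.Theorems.GenusKolyvaginAtTwoGenusPrimitiveSupplyAtTwoArchimedeanDescAdmissible
import Summits.BirchSwinnertonDyer.BirchSwinnertonDyer.Theorems.GenusKolyvaginAtTwoGenusPrimitiveSupplyAtTwoArchimedeanCapstone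
import Summits.BirchSwinnertonDyer.BirchSwinnertonDyer.Theorems.GenusKolyvaginAtTwoKramerParityHolds
import HarnessLib

/-!
# Route `GenusKolyvaginAtTwo`, crux #2 `GenusPrimitiveSupplyAtTwo` (stmt-BirchSwinnertonDyer-22136):
# the UP lane UNCONDITIONAL — Kramer parity, Poitou–Tate and Tate χ all discharged

Lead seat `bsd-line-gk2-p1` g10 (cell `bsd-f1-sign2`).  With `GenusKolyPR.kramerParity_holds` (this gen: the explicit
Poonen–Rains form + the KMR bridge), `poitouTate_selmerStructure_duality_real_holds` and `GenusKolyLowering.localEP` (earlier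
gens), the three displayed external inputs {Kramer parity, PT with real places, Tate χ} of the width seats' UP-lane theorems are
tree theorems; this file records the UNCONDITIONAL forms (statements verbatim, the three hypotheses removed):

* `supply_DEF1_minimalTwin_habitat` — SUPPLY″ on the habitat of the crux (beyond every bound a twisting prime `ℓ ≡ 7 (8)`,
  `K = ℚ(√−ℓ)` with every K-clause of 22136, and a globally minimal twin `Wd ≅ W^{(−ℓ)}` with `#Sel₂(Wd) = 2`), from
  `#Sel₂(W) ∈ {1, 4}` and the descent-sign clause only;
* `descentSignNeg_or_forall_minimalTwin` — row 1 on `Δ > 0` is decided by the descent sign;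
* `eggTwistLaw_habitat` — T-C `EggTwistLawAtTwo` ON THE HABITAT, unconditionally; `eggTwistLawAtTwo_of_offHabitat` — T-C by
  name from the off-habitat UP corner alone; `not_descentSignNeg_iff_meetsEgg_habitat` — `ε(W) = +1 ⟺ E(ℚ)` meets the egg.

THEOREMS ONLY (no definition, no named fact, no `sorry`); helper `--supports stmt-BirchSwinnertonDyer-22136`.  Honest framing:
these are supply / transfer statements of the route's UP lane; they do NOT touch (U) (stmt-24947) or (CONV₂) (stmt-19220/24948):
crux 22136 stays OPEN; the twin's analytic rank one is NOT asserted; BSD is not proved by any of this.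

References: [Kramer1981] Thm. 1, §2 Prop. 6; [MazurRubin2010] Thm. 2.7, Prop. 3.3, Cor. 3.4 (i); [KlagsbrunMazurRubin2013]
Thm. 3.9, Lemma 5.2; [PoonenRains2012] §4; [MilneADT2006] I Thm. 2.8, Thm. 4.10; [GrossLMS1991] §1.
-/

set_option linter.dupNamespace false -- tree convention: `Summit.BirchSwinnertonDyer.BirchSwinnertonDyer.Theorems` (summit = sub-problem)
set_option autoImplicit false

noncomputable section

open scoped Classical ContRepresentation

namespace Summit.BirchSwinnertonDyer.BirchSwinnertonDyer.Theorems.GenusKolyPR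

open WeierstrassCurve Field NumberField IsDedekindDomain Function
open Literature.NumberTheory.EllipticCurves Literature.NumberTheory.QuadraticFields
open Literature.NumberTheory.GaloisRepresentations Literature.NumberTheory.GaloisCohomology Literature.NumberTheory
open Summit.BirchSwinnertonDyer.Rank1Residual.F1Sign2
open Summit.BirchSwinnertonDyer.BirchSwinnertonDyer.Theorems.SchneiderFreeAdditiveX3.PoitouTateReduction
open Summit.BirchSwinnertonDyer.BirchSwinnertonDyer.Theorems.GenusKolyTwin
open Summit.BirchSwinnertonDyer.BirchSwinnertonDyer.Theorems.GenusKolyArch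

variable (W : WeierstrassCurve ℚ) [W.IsElliptic] [W.IsGloballyMinimal]

/-- **SUPPLY″ ON THE HABITAT OF CRUX 22136, UNCONDITIONALLY** (`supply_DEF1_minimalTwin_habitat_of_parity''` with Kramer parity,
Poitou–Tate and Tate χ discharged): for `W/ℚ` globally minimal elliptic with `ρ_{W,2^n}` onto for every `n ≥ 1`,
`#Sel₂(W) ∈ {1, 4}` and `¬ DescentSignNeg W` whenever `Δ_W > 0 ∧ #Sel₂(W) = 4`: beyond every bound `b` a prime `ℓ ≡ 7 (mod 8)`,
`ℓ ∤ N_W`, DEF(W, ℚ(√−ℓ)) = 1, `K = ℚ(√−ℓ)` carrying every K-clause of the crux with `2` split, and a globally minimal twin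
`Wd ≅ W^{(−ℓ)}` with `#Sel₂(Wd) = 2`. The twin's analytic rank is NOT asserted. [cite: MazurRubin2010, Thm. 2.7, Prop. 3.3, Cor. 3.4 (i)]
[cite: Kramer1981, Thm. 1] [cite: GrossLMS1991, §1 (p. 235)] -/
theorem supply_DEF1_minimalTwin_habitat
    (hρ : ∀ n : ℕ, 0 < n → W.HasSurjectiveModNGaloisRep ((2 : ℤ) ^ n))
    (h14 : Nat.card (W.selmerGroup 2) = 1 ∨ Nat.card (W.selmerGroup 2) = 4)
    (hε : 0 < W.Δ → Nat.card (W.selmerGroup 2) = 4 → ¬ DescentSignNeg W) (b : ℕ) :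
    ∃ ℓ : ℕ, b < ℓ ∧ ℓ.Prime ∧ ℓ % 8 = 7 ∧ ¬ ℓ ∣ W.conductorNorm ℤ ∧
      ((W.Δ < 0 ∧ ∃! x : ZMod ℓ, 4 * x ^ 3 + ((integralModelInt W).b₂ : ZMod ℓ) * x ^ 2 +
          2 * ((integralModelInt W).b₄ : ZMod ℓ) * x + ((integralModelInt W).b₆ : ZMod ℓ) = 0) ∨
        (0 < W.Δ ∧ ∀ x : ZMod ℓ, 4 * x ^ 3 + ((integralModelInt W).b₂ : ZMod ℓ) * x ^ 2 +
          2 * ((integralModelInt W).b₄ : ZMod ℓ) * x + ((integralModelInt W).b₆ : ZMod ℓ) ≠ 0)) ∧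
      ∃ (K : Type) (_ : Field K) (_ : NumberField K), IsImaginaryQuadratic K ∧ discr K = -(ℓ : ℤ) ∧ Odd (discr K) ∧
        discr K ≠ -3 ∧ SatisfiesHeegnerHypothesis (W.conductorNorm ℤ) K ∧
        ¬ IsSquare ((discr K : ℚ) * -|W.Δ|) ∧ ¬ IsSquare ((discr K : ℚ) * (-(2 * |W.Δ|))) ∧
        ((Ideal.span {(2 : ℤ)}).primesOver (𝓞 K)).ncard = 2 ∧
        ∃ (Wd : WeierstrassCurve ℚ) (_ : Wd.IsElliptic) (_ : Wd.IsGloballyMinimal),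
          (∃ C : VariableChange ℚ, C • W.quadraticTwist (discr K : ℚ) = Wd) ∧ Nat.card (Wd.selmerGroup 2) = 2 :=
  supply_DEF1_minimalTwin_habitat_of_parity'' W kramerParity_holds (poitouTate_selmerStructure_duality_real_holds (K := ℚ))
    (GenusKolyLowering.localEP ℚ) hρ h14 hε b

/-- **Row 1 on `Δ > 0` is decided by the descent sign, UNCONDITIONALLY** (`descentSignNeg_or_forall_minimalTwin_of_parity` with
Kramer parity, PT and Tate χ discharged). [cite: MazurRubin2010, Thm. 2.7, Cor. 3.4 (i)] [cite: Kramer1981, §2 Prop. 6] -/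
theorem descentSignNeg_or_forall_minimalTwin (hΔ : 0 < W.Δ)
    (hsurj : W.HasSurjectiveModNGaloisRep 2) (h4 : Nat.card (W.selmerGroup 2) = 4) :
    DescentSignNeg W ∨
      ∀ d : ℤ, DescAdmissible W d → ∀ (Wd : WeierstrassCurve ℚ) [Wd.IsElliptic],
        (∃ C : VariableChange ℚ, C • W.quadraticTwist (d : ℚ) = Wd) → Nat.card (Wd.selmerGroup 2) = 2 :=
  descentSignNeg_or_forall_minimalTwin_of_parity W (poitouTate_selmerStructure_duality_real_holds (K := ℚ))
    (GenusKolyLowering.localEP ℚ) kramerParity_holds hΔ hsurj h4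

omit W in
/-- **T-C `EggTwistLawAtTwo` ON THE HABITAT, UNCONDITIONALLY**: for every globally minimal elliptic `W/ℚ` with `ρ̄_{W,2}` onto,
`Δ_W > 0`, rank `1`, `Ш(W)[2] = 0` and every descent-admissible `d`:
`(MeetsEgg W → #Sel₂(W^{(d)}) = 1) ∧ (¬ MeetsEgg W → #Sel₂(W^{(d)}) = 4)`. [cite: Kramer1981, §2 Prop. 6, Thm. 1]
[cite: MazurRubin2010, Thm. 2.7, Cor. 3.4 (i)] -/
theorem eggTwistLaw_habitat :
    ∀ (W : WeierstrassCurve ℚ) [W.IsElliptic] [W.IsGloballyMinimal], W.HasSurjectiveModNGaloisRep 2 → 0 < W.Δ →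
      W.mordellWeilRank = 1 → ShaTwoTrivial W → ∀ d : ℤ, DescAdmissible W d →
        (MeetsEgg W → twistSelmerTwoCard W d = 1) ∧ (¬ MeetsEgg W → twistSelmerTwoCard W d = 4) :=
  eggTwistLaw_habitat_of_parity kramerParity_holds

omit W in
/-- **T-C `EggTwistLawAtTwo` BY NAME from the off-habitat UP corner alone** (Kramer parity discharged): the only displayed input
left is the UP direction for curves with non-surjective `ρ̄_{W,2}`. [cite: Kramer1981, §2 Prop. 6, Thm. 1] [cite: MazurRubin2010, Thm. 2.7] -/
theorem eggTwistLawAtTwo_of_offHabitat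
    (hoff : ∀ (W : WeierstrassCurve ℚ) [W.IsElliptic] [W.IsGloballyMinimal], ¬ W.HasSurjectiveModNGaloisRep 2 → 0 < W.Δ →
      NoRationalTwoTorsion W → W.mordellWeilRank = 1 → ShaTwoTrivial W → ¬ MeetsEgg W →
        ∀ d : ℤ, DescAdmissible W d → twistSelmerTwoCard W d = 4) :
    EggTwistLawAtTwo :=
  eggTwistLawAtTwo_of_parity_of_offHabitat kramerParity_holds hoff

/-- **`ε(W) = +1` iff `E(ℚ)` meets the egg, UNCONDITIONALLY on the habitat** (`ρ̄_{W,2}` onto, `Δ_W > 0`, `Ш(W)[2] = 0`).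
[cite: Kramer1981, §2 Prop. 6, Thm. 1] [cite: MazurRubin2010, Thm. 2.7, Cor. 3.4 (i)] -/
theorem not_descentSignNeg_iff_meetsEgg_habitat (hsurj : W.HasSurjectiveModNGaloisRep 2) (hΔ : 0 < W.Δ)
    (hSha : ShaTwoTrivial W) : ¬ DescentSignNeg W ↔ MeetsEgg W :=
  not_descentSignNeg_iff_meetsEgg_habitat_of_parity W kramerParity_holds hsurj hΔ hSha

/-! ## T-A, T-A′, T-V on the habitat, unconditionally (appended) -/

/-- **T-A `AdmissibleTwistSelmerShiftAtTwo` ON THE HABITAT, UNCONDITIONALLY**: for `W/ℚ` globally minimal elliptic with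
`ρ̄_{W,2}` onto, `Δ_W > 0` and a descent-admissible `d`, `#Sel₂(W^{(d)})` is `#Sel₂(W)/2` or `2·#Sel₂(W)`
(`admissibleTwistSelmerShift_habitat_of_parity` with Kramer parity, PT and Tate χ discharged).
[cite: MazurRubin2010, Thm. 2.7, Prop. 3.3] [cite: Kramer1981, Thm. 1] -/
theorem admissibleTwistSelmerShift_habitat (hsurj : W.HasSurjectiveModNGaloisRep 2) (hΔ : 0 < W.Δ)
    (d : ℤ) (hd : DescAdmissible W d) :
    2 * twistSelmerTwoCard W d = selmerTwoCard W ∨ twistSelmerTwoCard W d = 2 * selmerTwoCard W :=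
  admissibleTwistSelmerShift_habitat_of_parity (poitouTate_selmerStructure_duality_real_holds (K := ℚ))
    (GenusKolyLowering.localEP ℚ) kramerParity_holds W hsurj hΔ d hd

/-- **T-A′ (level law) ON THE HABITAT, UNCONDITIONALLY**: all descent-admissible twists of `W` have the same `#Sel₂`
(`admissibleTwistSelmerLevel_habitat_of_parity` with the three inputs discharged). [cite: MazurRubin2010, Thm. 2.7, Cor. 3.4 (i)]
[cite: Kramer1981, Thm. 1] -/
theorem admissibleTwistSelmerLevel_habitat (hsurj : W.HasSurjectiveModNGaloisRep 2) (hΔ : 0 < W.Δ)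
    {d d' : ℤ} (hd : DescAdmissible W d) (hd' : DescAdmissible W d') :
    twistSelmerTwoCard W d = twistSelmerTwoCard W d' :=
  admissibleTwistSelmerLevel_habitat_of_parity W (poitouTate_selmerStructure_duality_real_holds (K := ℚ))
    (GenusKolyLowering.localEP ℚ) kramerParity_holds hsurj hΔ hd hd'

/-- **T-V `StrictShaPropagationAtTwo` ON THE HABITAT, UNCONDITIONALLY**: for `W/ℚ` globally minimal with `ρ̄_{W,2}` onto,
`Δ_W > 0` and `#Sel₂(W) = 4`, either every descent-admissible twist has `#Sel₂ = 2` or every one has `#Sel₂ = 8`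
(`strictShaPropagation_habitat_of_parity` with the three inputs discharged). [cite: MazurRubin2010, Thm. 2.7, Cor. 3.4 (i)]
[cite: Kramer1981, §2 Prop. 6] -/
theorem strictShaPropagation_habitat (hsurj : W.HasSurjectiveModNGaloisRep 2) (hΔ : 0 < W.Δ)
    (h4 : selmerTwoCard W = 4) :
    (∀ d : ℤ, DescAdmissible W d → twistSelmerTwoCard W d = 2) ∨
      (∀ d : ℤ, DescAdmissible W d → twistSelmerTwoCard W d = 8) :=
  strictShaPropagation_habitat_of_parity W (poitouTate_selmerStructure_duality_real_holds (K := ℚ))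
    (GenusKolyLowering.localEP ℚ) kramerParity_holds hsurj hΔ h4

/-! ## The prime Heegner twin (MR Cor. 3.4 (i) at the twisting prime), unconditionally (appended) -/

/-- **MR Cor. 3.4 (i) for the prime Heegner twin, UNCONDITIONALLY** (`GenusKolyTwin.cor34i_twin_prime_heegner_of_duality_of_parity`
with PT, Tate χ and Kramer parity discharged): at the prime `ℓ` of a prime Heegner field `K = ℚ(√−ℓ)` (`Δ_W < 0`, `d_K = −ℓ` odd,
Heegner, `2` split), for every elliptic model `Wd ≅ W^{(−ℓ)}`: `Sel₂(W)` strict at `ℓ` ⟹ `#Sel₂(Wd) = 2·#Sel₂(W)`; not strict ⟹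
`#Sel₂(W) = 2·#Sel₂(Wd)`. [cite: MazurRubin2010, Cor. 3.4 (i) with Thm. 2.7] [cite: MilneADT2006, I Thm. 4.10] -/
theorem cor34i_twin_prime_heegner {K : Type} [Field K] [NumberField K] (hsurj : W.HasSurjectiveModNGaloisRep 2)
    (hΔ : W.Δ < 0) (hK : IsImaginaryQuadratic K) (hodd : Odd (discr K))
    (hH : SatisfiesHeegnerHypothesis (W.conductorNorm ℤ) K) (h2K : ((Ideal.span {(2 : ℤ)}).primesOver (𝓞 K)).ncard = 2)
    {ℓ : ℕ} [Fact ℓ.Prime] (hd : discr K = -(ℓ : ℤ)) (Wd : WeierstrassCurve ℚ) [Wd.IsElliptic]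
    (hWd : ∃ C : VariableChange ℚ, C • W.quadraticTwist (discr K : ℚ) = Wd) :
    (W.selmerGroup 2 ≤ MazurRubin2010.strictLocalKer W ℚ_[ℓ] 2 →
        Nat.card (Wd.selmerGroup 2) = 2 * Nat.card (W.selmerGroup 2)) ∧
      (¬ W.selmerGroup 2 ≤ MazurRubin2010.strictLocalKer W ℚ_[ℓ] 2 →
        Nat.card (W.selmerGroup 2) = 2 * Nat.card (Wd.selmerGroup 2)) :=
  cor34i_twin_prime_heegner_of_duality_of_parity W (poitouTate_selmerStructure_duality_real_holds (K := ℚ))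
    (GenusKolyLowering.localEP ℚ) kramerParity_holds hsurj hΔ hK hodd hH h2K hd Wd hWd

/-- **On `#Sel₂(W) = 1` the prime Heegner twin is `Sel₂`-minimal, UNCONDITIONALLY**: `#Sel₂(Wd) = 2`.
[cite: MazurRubin2010, Cor. 3.4 (i) with Thm. 2.7] [cite: MilneADT2006, I Thm. 4.10] -/
theorem natCard_selmerGroup_twin_eq_two {K : Type} [Field K] [NumberField K] (hsurj : W.HasSurjectiveModNGaloisRep 2)
    (hΔ : W.Δ < 0) (hK : IsImaginaryQuadratic K) (hodd : Odd (discr K))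
    (hH : SatisfiesHeegnerHypothesis (W.conductorNorm ℤ) K) (h2K : ((Ideal.span {(2 : ℤ)}).primesOver (𝓞 K)).ncard = 2)
    {ℓ : ℕ} [Fact ℓ.Prime] (hd : discr K = -(ℓ : ℤ)) (Wd : WeierstrassCurve ℚ) [Wd.IsElliptic]
    (hWd : ∃ C : VariableChange ℚ, C • W.quadraticTwist (discr K : ℚ) = Wd)
    (h1 : Nat.card (W.selmerGroup 2) = 1) : Nat.card (Wd.selmerGroup 2) = 2 :=
  natCard_selmerGroup_twin_eq_two_of_parity W (poitouTate_selmerStructure_duality_real_holds (K := ℚ))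
    (GenusKolyLowering.localEP ℚ) kramerParity_holds hsurj hΔ hK hodd hH h2K hd Wd hWd h1

/-- **On `#Sel₂(W) = 4` the prime Heegner twin is `Sel₂`-minimal iff `Sel₂(W)` is not strict at `ℓ`, UNCONDITIONALLY.**
[cite: MazurRubin2010, Cor. 3.4 (i) with Thm. 2.7] [cite: MilneADT2006, I Thm. 4.10] -/
theorem natCard_selmerGroup_twin_eq_two_iff_not_strict {K : Type} [Field K] [NumberField K]
    (hsurj : W.HasSurjectiveModNGaloisRep 2)
    (hΔ : W.Δ < 0) (hK : IsImaginaryQuadratic K) (hodd : Odd (discr K))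
    (hH : SatisfiesHeegnerHypothesis (W.conductorNorm ℤ) K) (h2K : ((Ideal.span {(2 : ℤ)}).primesOver (𝓞 K)).ncard = 2)
    {ℓ : ℕ} [Fact ℓ.Prime] (hd : discr K = -(ℓ : ℤ)) (Wd : WeierstrassCurve ℚ) [Wd.IsElliptic]
    (hWd : ∃ C : VariableChange ℚ, C • W.quadraticTwist (discr K : ℚ) = Wd)
    (h4 : Nat.card (W.selmerGroup 2) = 4) :
    Nat.card (Wd.selmerGroup 2) = 2 ↔ ¬ W.selmerGroup 2 ≤ MazurRubin2010.strictLocalKer W ℚ_[ℓ] 2 :=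
  natCard_selmerGroup_twin_eq_two_iff_not_strict_of_duality_of_parity W
    (poitouTate_selmerStructure_duality_real_holds (K := ℚ)) (GenusKolyLowering.localEP ℚ) kramerParity_holds hsurj hΔ hK
    hodd hH h2K hd Wd hWd h4

/-! ## Over every number field: the T-A dichotomy with one real `T`-place, unconditionally (appended) -/

/-- **MR Cor. 3.4 (i) / T-A DICHOTOMY OVER EVERY NUMBER FIELD, UNCONDITIONALLY** (`natCard_selmerGroup_twist_shift_of_places_inl`
with Poitou–Tate (`poitouTate_selmerStructure_duality_real_holds`), Tate χ (`GenusKolyLowering.localEP`) and Kramer parity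
(`kramerParity_holds`, every `K`) discharged): `W/K` elliptic with `ρ̄_{W,2}` onto, `Wd = C • W^{(d)}` elliptic, `d` a non-square in
`K` and in `K_{w₀}` for a real place `w₀` with `w₀(Δ_W) > 0`, every finite place split / odd-good / odd-silent, every other infinite
place split / `H¹ = 0`: then `#Sel₂(Wd)·2 = #Sel₂(W)` or `#Sel₂(Wd) = #Sel₂(W)·2`.
[cite: MazurRubin2010, Thm. 2.7, Lemma 2.9, Prop. 3.3, Cor. 3.4 (i)] [cite: Kramer1981, Thm. 1] [cite: MilneADT2006, I Thm. 2.13, 4.10] -/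
theorem natCard_selmerGroup_twist_shift_of_places_inl_unconditional {K : Type} [Field K] [NumberField K]
    (V : WeierstrassCurve K) [V.IsElliptic] (hsurj : V.HasSurjectiveModNGaloisRep 2)
    {d : K} (hdsq : ∀ x : K, x ^ 2 ≠ d) {Vd : WeierstrassCurve K} [Vd.IsElliptic] {C : VariableChange K}
    (hVd : C • V.quadraticTwist d = Vd)
    {w₀ : InfinitePlace K} (hw₀ : w₀.IsReal) (hΔ : 0 < InfinitePlace.embedding_of_isReal hw₀ V.Δ)
    (hdsq₀ : ∀ s : w₀.Completion, s ^ 2 ≠ algebraMap K w₀.Completion d)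
    (hfin : ∀ v : HeightOneSpectrum (𝓞 K),
      (∃ s : v.adicCompletion K, s ^ 2 = algebraMap K (v.adicCompletion K) d) ∨
      (((2 : ℕ) : 𝓞 K) ∉ v.asIdeal ∧ V.HasGoodReductionAt v ∧ Vd.HasGoodReductionAt v) ∨
      (((2 : ℕ) : 𝓞 K) ∉ v.asIdeal ∧
        Nat.card (nsmulAddMonoidHom 2 : (V.baseChange (v.adicCompletion K)).toAffine.Point →+ _).ker = 1 ∧
        Nat.card (nsmulAddMonoidHom 2 : (Vd.baseChange (v.adicCompletion K)).toAffine.Point →+ _).ker = 1))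
    (hinf : ∀ w : InfinitePlace K, w ≠ w₀ →
      (∃ s : w.Completion, s ^ 2 = algebraMap K w.Completion d) ∨
      ((∀ x : galoisCohomology (V.localGaloisModule w.Completion) 1, x = 0) ∧
        (∀ x : galoisCohomology (Vd.localGaloisModule w.Completion) 1, x = 0))) :
    Nat.card (Vd.selmerGroup ((2 : ℕ) : ℤ)) * 2 = Nat.card (V.selmerGroup ((2 : ℕ) : ℤ)) ∨
      Nat.card (Vd.selmerGroup ((2 : ℕ) : ℤ)) = Nat.card (V.selmerGroup ((2 : ℕ) : ℤ)) * 2 :=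
  natCard_selmerGroup_twist_shift_of_places_inl V (poitouTate_selmerStructure_duality_real_holds (K := K))
    (GenusKolyLowering.localEP K) kramerParity_holds hsurj hdsq hVd hw₀ hΔ hdsq₀ hfin hinf

end Summit.BirchSwinnertonDyer.BirchSwinnertonDyer.Theorems.GenusKolyPR

end
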